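/-
Copyright (c) 2026 the pub-hodgecm-mathlib formalisation cell (harness21).  Prover seat hodgecm-mathlib-K2E1-p08 (g5), Track B ∕ K2-LIT, h413 =
`stmt-HodgeConjecture-24833`, campaign «EIS-RANK-ONE» rung R4 «EIS-R4-growth», road (A), file (A2); DEAL BY NAME of the dealer K2E1-plan (g3) 2026-09-04T05:32:09Z
([D3]; spec of record K2E4-p11 (g3) 05:27:07Z over ★ p857629 (A1) `K2E1RationalPointsNearBorel`).
-/
import Literature.NumberTheory.Automorphic.UnitaryGroupBorelSiegelSetStructure       -- ★ cell road H4-d ∕ H9b: the `O(δ_B)` cell count on a Siegel set, root values, torus contraction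
import Literature.NumberTheory.Automorphic.UnitaryGroupHeisenbergFundamentalDomain     -- ★ Tate's fundamental domain `𝓕_N = heisChart(D_E × 𝓕⁻)` of `N(F)` in `N(𝔸_F)`, inside a compact set
import Literature.NumberTheory.Automorphic.UnitaryGroupTruncatedKernelCellBound        -- ★ `measure_ne_zero_of_isFundamentalDomain` (`ν(𝓕) ≠ 0`)
import Summits.HodgeConjecture.HodgeConjecture.Theorems.K2E1BorelParabolicIntegralU3   -- ★ p857444 (K2E4-p11 g3): `torusRootModulus_diagUnit_eq_borelHeight_mul_self` (`δ_B = H²` at `N = 3`)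
import Summits.HodgeConjecture.HodgeConjecture.Theorems.K2E1SiegelMassU3               -- ★ p856436 (K2E1-p02 g3): `exists_ray_of_adelicVal_mem_siegelCone` (a cone element IS `diag(z(r), 1, z(r)⁻¹)`, `r ≥ t`)
import HarnessLib

/-!
# K2·E1 — `K2E1BorelLatticeCount` (rung R4 «moderate growth», road (A), file (A2)): ON A SIEGEL SET THE RATIONAL BOREL ELEMENTS CONJUGATE TO A
# COMPACT SET NUMBER `O(δ_B) = O(H²)` — `#(B(F)♯ ∩ b·D·b⁻¹) ≤ M · δ_B(b) = M · H(b)²` for `b = ω · a(r)`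

Track B ∕ K2-LIT, crux h413 = `stmt-HodgeConjecture-24833`, route of record `HCCMUnconditional`; cell `hodgecm-mathlib`, squad K2, ENGINE E1, campaign EIS-RANK-ONE
rung R4 (moderate growth of the Borel Eisenstein series on Siegel sets), road (A) «Godement's count» (dealer K2E1-plan (g3) 05:32:09Z [D3]; spec K2E4-p11 (g3) 05:27:07Z;
census K2E1-p08 (g4) 05:08:07Z, K2E4-p14 (g5) 05:13:14Z).  Prover seat `hodgecm-mathlib-K2E1-p08` (g5).  THEOREMS ONLY (no `def`, no `instance`, no notation, no
named-fact hypothesis, no `sorry`); lane `--kind proof --supports stmt-HodgeConjecture-24833 --as helper` (count-neutral, closes no socket).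

THE ROAD.  ★ (G0) `K2E1GodementCount.tsum_le_mul_lintegral_weight` bounds `Σ'_q ψ₁(γ̃_q g) ≤ (A·m ∕ μC)·∫⁻ ψ₂ β'` with the MULTIPLICITY `m = #(G(F) ∩ (g•C)(g•C)⁻¹)`,
and ★ (A1) `K2E1RationalPointsNearBorel` cuts that set down, for `g = b·k` of large height, to `B(F)♯ ∩ {x | ∃ d ∈ D, x b = b d}` (`D = K(CC⁻¹)K⁻¹` compact).  THIS FILE
COUNTS THAT SET: `≤ M·δ_B(b) = M·H(b)²` when `b = ω·a` runs over the Borel part `Ω · A(t)` of the Siegel set `𝔖 = Ω · A(t) · K` of ★ `K2E1ReductionTheoryU3.exists_siegel_cover_three`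
— the one missing growth input of (A3) `K2E1BorelEisensteinModerateGrowth` (`m_g ≤ M·H(g)^{2ρ_H}`, hence `Σ'_q H(γ̃_q g)^τ ≪ H(g)²·H(g)^{τ−2} = H(g)^τ`).

SURVEY-★-FIRST.  The count itself IS ★ in the tree's Literature, on the cell road of the truncated kernel (brick H4-d): ★
`UnitaryGroup.exists_forall_card_mul_measure_le_mul_torusRootModulus` (`UnitaryGroupBorelLatticeCellCountSiegel` §5) — for a Haar measure `ν` of `N(𝔸_F)`, a fundamental domain
`𝓕 ⊆ W₀` of `N(F)` and compacta `U, C, K, Ω, R₁, R₂`: `#R · ν(𝓕) ≤ C₀ · δ_B(b)` for every finite `R ⊆ B(F)` with `(bk)⁻¹ β (y·bk) ∈ C` and every `b ∈ B(𝔸_F)` whose UNIPOTENT PART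
`(torusPart b)⁻¹ b` lies in `Ω` and whose ROOT VALUES `d₀⁻¹d₁`, `d₀⁻¹d₂` lie in `R₁`, `R₂` — exactly the spec's (i) torus fibres finite (★ `finite_setOf_rationalTorus_conj_mem_of_isCompact`),
(ii)+(iii) the lattice count along `B(F) = T(F)N(F)` by the cells `n𝓕` (★ `card_mul_measure_le_tsum_measure`), `ν{u : b⁻¹ub ∈ X} = δ_B(b)·ν(X)` (★ `measure_cellSet_borel_mul_le`) and
the torus CONTRACTION in the Heisenberg chart (★ `exists_isCompact_torusConj_mem`).  So this file is the ADAPTER from that brick to the (A1)∕(A3) currency: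
* §1 (any `N`) `finite_borelRational_inter_conj` — `B(F)♯ ∩ {x | ∃ d ∈ D, x b = b d}` is finite for compact `D` (★ `finite_setOf_mem_arithmeticSubgroup_of_isCompact`);
  `subset_borelAdelic_of_image_subset` — the letters `adelicVal '' Ω ⊆ N(𝔸)·T(𝔸)¹` of ★ `exists_siegel_cover_three` give `Ω ⊆ B(𝔸_F)`.
* §2 (`N = 3`, hypotheses-first) **`exists_forall_ncard_le_mul_torusRootModulus`** — `∃ M, #(B(F)♯ ∩ bDb⁻¹) ≤ M·δ_B(b)` for every `b` with unipotent part in `Ω'` and root values in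
  `R₁, R₂`: ★ H4-d with `U = K = {1}`, the Haar measure `ν := haar` and Tate's `𝓕_N` (★ `isFundamentalDomain_heisFundamentalDomain`, ★ `exists_isCompact_heisFundamentalDomain_subset`,
  `0 < ν(𝓕_N) < ∞` ★ `measure_ne_zero_of_isFundamentalDomain`) DISCHARGED inside the proof, `M = C₀ ∕ ν(𝓕_N)`.
* §3 (`N = 3`) **`exists_isCompact_structure_of_mem_mul_cone`** — THE SIEGEL DISCHARGE: for compact `Ω ⊆ B(𝔸_F)` and `t > 0` there are compact `Ω', R₁, R₂` such that every
  `b = ω·a` (`ω ∈ Ω`, `adelicVal a ∈ siegelCone 3 E t`, i.e. `a = diag(z(r), 1, z(r)⁻¹)`, `r ≥ t`, ★ `exists_ray_of_adelicVal_mem_siegelCone`) has unipotent part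
  `(torusPart b)⁻¹ b = a⁻¹ n_ω a ∈ Ω'` (`n_ω = (torusPart ω)⁻¹ω` ranges in a compact of `N(𝔸_F)`; contraction ★ `exists_isCompact_torusConj_mem` with the windows
  `z(r⁻¹) ∈ realAdele(E) '' [0, t⁻¹]`, COMPACT AS ADELES) and root values `ρᵢ(torusPart ω)·z(r⁻¹)^i ∈ Rᵢ` (★ `rootValue₁_mul`, ★ `rootValue₂_mul`, ★ `continuous_rootValueᵢ`).
* §4 **`exists_forall_ncard_le_mul_borelHeight_sq`** — THE HEAD IN (A3)'s CURRENCY: `∃ M, ∀ ω ∈ Ω, ∀ a ∈ A(t), #(B(F)♯ ∩ {x | x (ωa) = (ωa) d, d ∈ D}) ≤ M · H(ωa)²`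
  (§2 + §3 + ★ `torusRootModulus_diagUnit_eq_borelHeight_mul_self`), and `…_of_image_subset` in the letters of ★ `exists_siegel_cover_three`.
[Rogawski1990, §2.2 p. 13; Arthur1978TraceFormulaI, §5 (on a Siegel set the number of `β ∈ B(F)` with `g⁻¹βg` in a compact set is `O(δ_B)`); MoeglinWaldspurger1995, I.2.4, II.1.5;
Godement1964, §8; Borel1963, §5.]

HONEST LABEL: HC_CM is proved only modulo the 7 printed citations (2 remaining named inputs: hLiu418 = `stmt-HodgeConjecture-24832`, h413 = `stmt-HodgeConjecture-24833`) until
rung 0 closes; count-neutral helper, closes no socket.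

## References
* [Rogawski1990] J. D. Rogawski, *Automorphic Representations of Unitary Groups in Three Variables*, Ann. of Math. Stud. 123 (1990), §2.2 (p. 13).
* [Arthur1978TraceFormulaI] J. Arthur, *A trace formula for reductive groups I*, Duke Math. J. 45 (1978), §5.
* [MoeglinWaldspurger1995] C. Mœglin, J.-L. Waldspurger, *Spectral Decomposition and Eisenstein Series* (1995), I.2.4, II.1.5.
* [Godement1964] R. Godement, *Domaines fondamentaux des groupes arithmétiques*, Sém. Bourbaki 257 (1962∕63), §8.
* [Borel1963] A. Borel, *Some finiteness properties of adele groups over number fields*, Publ. Math. IHÉS 16 (1963), §5.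
-/

set_option autoImplicit false
-- the mandated namespace repeats the single-problem summit's segment (`HodgeConjecture.HodgeConjecture`)
set_option linter.dupNamespace false

noncomputable section

open Set MeasureTheory MeasureTheory.Measure Topology NumberField IsDedekindDomain
open scoped NNReal ENNReal Pointwise MatrixGroups
open Literature.NumberTheory.Automorphic Literature.NumberTheory.Automorphic.UnitaryGroup
open Summit.HodgeConjecture.HodgeConjecture.Cruxes.H413.K2E1SiegelMassU3 (exists_ray_of_adelicVal_mem_siegelCone)
open Summit.HodgeConjecture.HodgeConjecture.Cruxes.H413.K2E1BorelParabolicIntegralU3 (torusRootModulus_diagUnit_eq_borelHeight_mul_self)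

namespace Summit.HodgeConjecture.HodgeConjecture.Cruxes.H413.K2E1BorelLatticeCount

variable {F E : Type} [Field F] [NumberField F] [Field E] [NumberField E] [Algebra F E] {c : E ≃ₐ[F] E} {N : ℕ}

/-! ## §1 The set to count is finite; the Siegel `Ω` lies in `B(𝔸_F)` -/

/-- **`B(F)♯ ∩ {x | ∃ d ∈ D, x b = b d}` IS FINITE** for compact `D ⊆ G(𝔸_F)` and any `b ∈ G(𝔸_F)`: it lies in the image of `{γ ∈ G(F) | b⁻¹ γ b ∈ D}`, a discrete group meeting
a compact set (★ `finite_setOf_mem_arithmeticSubgroup_of_isCompact`).  Here `B(F)♯ = (arithmeticBorel).map (arithmeticSubgroup).subtype ⊆ G(𝔸_F)`, the letters of ★ (A1)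
`K2E1RationalPointsNearBorel`. [cite: Garrett2018, §1.8] [cite: MoeglinWaldspurger1995, I.2.4] -/
theorem finite_borelRational_inter_conj {D : Set (quasiSplit F E c N).Adelic} (hD : IsCompact D) (b : (quasiSplit F E c N).Adelic) :
    (((arithmeticBorel F E c N).map (quasiSplit F E c N).arithmeticSubgroup.subtype : Set (quasiSplit F E c N).Adelic) ∩
      {x | ∃ d ∈ D, x * b = b * d}).Finite := by
  refine ((finite_setOf_mem_arithmeticSubgroup_of_isCompact hD b b).image
    fun γ : (quasiSplit F E c N).arithmeticSubgroup => (γ : (quasiSplit F E c N).Adelic)).subset ?_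
  rintro x ⟨hx, d, hd, hxd⟩
  obtain ⟨β, -, rfl⟩ := Subgroup.mem_map.1 hx
  refine ⟨β, ?_, rfl⟩
  change b⁻¹ * (β : (quasiSplit F E c N).Adelic) * b ∈ D
  rw [mul_assoc, show (β : (quasiSplit F E c N).Adelic) * b = b * d from hxd, inv_mul_cancel_left]
  exact hd

/-- **The Siegel `Ω` lies in `B(𝔸_F)`**: if the matrices of `Ω` lie in `N(𝔸_E)·T(𝔸_E)¹` (upper unitriangular times norm-one diagonal — the letters of ★
`K2E1ReductionTheoryU3.exists_siegel_cover_three`), then `Ω ⊆ B(𝔸_F)` (products of upper triangular matrices are upper triangular). [cite: Borel1963, §5]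
[cite: Rogawski1990, §2.2 (p. 13)] -/
theorem subset_borelAdelic_of_image_subset {Ω : Set (quasiSplit F E c N).Adelic}
    (hΩ : adelicVal F E c N ((StdForm.antidiagonal N).over E) '' Ω ⊆
      (upperUnitriangular (Fin N) (AdeleRing (𝓞 E) E) : Set (GL (Fin N) (AdeleRing (𝓞 E) E))) *
        (normOneDiagonal N E : Set (GL (Fin N) (AdeleRing (𝓞 E) E)))) :
    Ω ⊆ (borelAdelic F E c N : Set (quasiSplit F E c N).Adelic) := by
  intro ω hω
  obtain ⟨u, hu, m, hm, hum⟩ := Set.mem_mul.1 (hΩ (Set.mem_image_of_mem _ hω))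
  rw [SetLike.mem_coe, mem_borelAdelic_iff, ← hum, Units.val_mul]
  obtain ⟨d, -, rfl⟩ := mem_normOneDiagonal_iff.1 hm
  refine ((mem_upperUnitriangular_iff u).1 hu).1.mul ?_
  rw [coe_glDiagonal]
  exact Matrix.blockTriangular_diagonal _

/-! ## §2 The count, hypotheses-first (`N = 3`): `#(B(F)♯ ∩ bDb⁻¹) ≤ M · δ_B(b)` -/

/-- **THE `O(δ_B)` COUNT OF RATIONAL BOREL ELEMENTS, HYPOTHESES-FIRST** (`N = 3`).  For compact `D, Ω' ⊆ G(𝔸_F)` and `R₁, R₂ ⊆ 𝔸_E` there is `M : ℝ≥0` such that for every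
`b ∈ B(𝔸_F)` whose unipotent part `(torusPart b)⁻¹ b` lies in `Ω'` and whose root values `d₀⁻¹ d₁`, `d₀⁻¹ d₂` (`d = diagUnit b`) lie in `R₁`, `R₂`:
  `#(B(F)♯ ∩ {x | ∃ d ∈ D, x b = b d}) ≤ M · δ_B(b)`,  `δ_B(b) = torusRootModulus E 3 (diagUnit b)`.
This is ★ `exists_forall_card_mul_measure_le_mul_torusRootModulus` (brick H4-d: `#R · ν(𝓕) ≤ C₀ · δ_B(b)`) at `U = K = {1}`, with the Haar measure `ν` of `N(𝔸_F)` and Tate's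
fundamental domain `𝓕_N` of `N(F)` (★ `isFundamentalDomain_heisFundamentalDomain`, inside a compact ★ `exists_isCompact_heisFundamentalDomain_subset`, `0 < ν(𝓕_N) < ∞`) supplied
here, `M = C₀ ∕ ν(𝓕_N)`; the finite set is §1. [cite: Rogawski1990, §2.2 (p. 13)] [cite: Arthur1978TraceFormulaI, §5] -/
theorem exists_forall_ncard_le_mul_torusRootModulus (hc : c * c = 1) (hc1 : c ≠ 1)
    {D : Set (quasiSplit F E c 3).Adelic} (hD : IsCompact D) {Ω' : Set (quasiSplit F E c 3).Adelic} (hΩ' : IsCompact Ω')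
    {R₁ R₂ : Set (AdeleRing (𝓞 E) E)} (hR₁ : IsCompact R₁) (hR₂ : IsCompact R₂) :
    ∃ M : ℝ≥0, ∀ b : borelAdelic F E c 3,
      (((torusPart b)⁻¹ * b : borelAdelic F E c 3) : (quasiSplit F E c 3).Adelic) ∈ Ω' →
      (((diagUnit b.2 0)⁻¹ * diagUnit b.2 1 : (AdeleRing (𝓞 E) E)ˣ) : AdeleRing (𝓞 E) E) ∈ R₁ →
      (((diagUnit b.2 0)⁻¹ * diagUnit b.2 2 : (AdeleRing (𝓞 E) E)ˣ) : AdeleRing (𝓞 E) E) ∈ R₂ →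
      (((((arithmeticBorel F E c 3).map (quasiSplit F E c 3).arithmeticSubgroup.subtype : Set (quasiSplit F E c 3).Adelic) ∩
          {x | ∃ d ∈ D, x * (b : (quasiSplit F E c 3).Adelic) = (b : (quasiSplit F E c 3).Adelic) * d}).ncard : ℕ) : ℝ≥0) ≤
        M * torusRootModulus E 3 (diagUnit b.2) := by
  classical
  -- plumbing: `N(𝔸_F)` is a closed subgroup of the locally compact `G(𝔸_F)`; Borel σ-algebras
  haveI : T2Space (AdeleRing (𝓞 E) E) := t2Space_adeleRing_of_numberField E
  letI : MeasurableSpace (AdeleRing (𝓞 E) E) := borel _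
  haveI : BorelSpace (AdeleRing (𝓞 E) E) := ⟨rfl⟩
  haveI : LocallyCompactSpace (quasiSplit F E c 3).Adelic :=
    inferInstanceAs (LocallyCompactSpace (adelic F E c 3 ((StdForm.antidiagonal 3).over E)))
  have hNcl : IsClosed ((adelicUnipotent F E c 3 : Set (quasiSplit F E c 3).Adelic)) := by
    change IsClosed (⇑(adelicVal F E c 3 ((StdForm.antidiagonal 3).over E)) ⁻¹'
      ((upperUnitriangular (Fin 3) (AdeleRing (𝓞 E) E) : Subgroup (GL (Fin 3) (AdeleRing (𝓞 E) E))) :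
        Set (GL (Fin 3) (AdeleRing (𝓞 E) E))))
    exact (isClosed_upperUnitriangular (R := AdeleRing (𝓞 E) E)).preimage continuous_subtype_val
  haveI : LocallyCompactSpace (adelicUnipotent F E c 3) := hNcl.locallyCompactSpace
  letI : MeasurableSpace (adelicUnipotent F E c 3) := borel _
  haveI : BorelSpace (adelicUnipotent F E c 3) := ⟨rfl⟩
  set ν : Measure (adelicUnipotent F E c 3) := Measure.haar with hν
  -- Tate's fundamental domain of `N(F)`, inside a compact set, of positive finite Haar measure
  obtain ⟨W₀, hW₀, h𝓕W₀⟩ := exists_isCompact_heisFundamentalDomain_subset (F := F) (E := E) (c := c) hc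
  have h𝓕 := isFundamentalDomain_heisFundamentalDomain (F := F) (E := E) (c := c) hc ν
  have hν0 : ν (heisFundamentalDomain F E c hc) ≠ 0 := measure_ne_zero_of_isFundamentalDomain ν h𝓕
  have hνtop : ν (heisFundamentalDomain F E c hc) ≠ ∞ := ((measure_mono h𝓕W₀).trans_lt hW₀.measure_lt_top).ne
  -- brick H4-d at `U = K = {1}`
  obtain ⟨C₀, hC₀⟩ := exists_forall_card_mul_measure_le_mul_torusRootModulus hc hc1 ν h𝓕 hW₀ h𝓕W₀
    (isCompact_singleton (x := (1 : adelicUnipotent F E c 3))) hD (isCompact_singleton (x := (1 : (quasiSplit F E c 3).Adelic))) hΩ' hR₁ hR₂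
  set m : ℝ≥0 := (ν (heisFundamentalDomain F E c hc)).toNNReal with hm
  have hm0 : m ≠ 0 := ENNReal.toNNReal_ne_zero.2 ⟨hν0, hνtop⟩
  have hmν : (m : ℝ≥0∞) = ν (heisFundamentalDomain F E c hc) := ENNReal.coe_toNNReal hνtop
  refine ⟨C₀ * m⁻¹, fun b hΩb h₁ h₂ => ?_⟩
  -- the finite set `S` as the image of a `Finset` of `B(F)`
  set S : Set (quasiSplit F E c 3).Adelic :=
    ((arithmeticBorel F E c 3).map (quasiSplit F E c 3).arithmeticSubgroup.subtype : Set (quasiSplit F E c 3).Adelic) ∩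
      {x | ∃ d ∈ D, x * (b : (quasiSplit F E c 3).Adelic) = (b : (quasiSplit F E c 3).Adelic) * d} with hS
  have hSfin : S.Finite := finite_borelRational_inter_conj hD (b : (quasiSplit F E c 3).Adelic)
  set f : arithmeticBorel F E c 3 → (quasiSplit F E c 3).Adelic :=
    fun β => ((β : (quasiSplit F E c 3).arithmeticSubgroup) : (quasiSplit F E c 3).Adelic) with hf
  have hfinj : Function.Injective f := fun β β' h => Subtype.ext (Subtype.ext h)
  have hpre : (f ⁻¹' S).Finite := hSfin.preimage hfinj.injOn
  set R : Finset (arithmeticBorel F E c 3) := hpre.toFinset with hR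
  have hSsub : S ⊆ Set.range f := by
    rintro x ⟨hx, -⟩
    obtain ⟨β, hβ, rfl⟩ := Subgroup.mem_map.1 hx
    exact ⟨⟨β, hβ⟩, rfl⟩
  have hcard : S.ncard = R.card := by
    rw [← Set.image_preimage_eq_of_subset hSsub, Set.ncard_image_of_injective _ hfinj, ← hpre.coe_toFinset, Set.ncard_coe_finset]
  -- the hypothesis of H4-d: `b⁻¹ β b ∈ D`
  have hRD : ∀ β ∈ R, ∃ y ∈ ({1} : Set (adelicUnipotent F E c 3)),
      ((b : (quasiSplit F E c 3).Adelic) * 1)⁻¹ * (((β : (quasiSplit F E c 3).arithmeticSubgroup)) : (quasiSplit F E c 3).Adelic) *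
        ((y : (quasiSplit F E c 3).Adelic) * ((b : (quasiSplit F E c 3).Adelic) * 1)) ∈ D := by
    intro β hβ
    have hβS : f β ∈ S := by
      rw [hR, Set.Finite.mem_toFinset] at hβ
      exact hβ
    obtain ⟨-, d, hd, hβd⟩ := hβS
    refine ⟨1, rfl, ?_⟩
    rw [mul_one, OneMemClass.coe_one, one_mul, mul_assoc, show f β * (b : (quasiSplit F E c 3).Adelic) = _ * d from hβd, inv_mul_cancel_left]
    exact hd
  have key := hC₀ b hΩb h₁ h₂ 1 (Set.mem_singleton 1) R hRD
  -- `#R · ν(𝓕) ≤ C₀ · δ_B(b)` ⟹ `#R ≤ (C₀ ∕ ν(𝓕)) · δ_B(b)`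
  rw [← hmν] at key
  have key' : ((R.card : ℝ≥0) : ℝ≥0∞) * (m : ℝ≥0∞) ≤ ((C₀ * torusRootModulus E 3 (diagUnit b.2) : ℝ≥0) : ℝ≥0∞) := by
    rw [ENNReal.coe_mul]
    exact_mod_cast key
  rw [← ENNReal.coe_mul, ENNReal.coe_le_coe] at key'
  rw [hcard]
  calc (R.card : ℝ≥0) = (R.card : ℝ≥0) * m * m⁻¹ := by rw [mul_inv_cancel_right₀ hm0]
    _ ≤ C₀ * torusRootModulus E 3 (diagUnit b.2) * m⁻¹ := by gcongr
    _ = C₀ * m⁻¹ * torusRootModulus E 3 (diagUnit b.2) := by ring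

/-! ## §3 The Siegel discharge: `b = ω·a(r)` has unipotent part in a compact and root values in compact windows -/

/-- The diagonal entries of a cone element: if `adelicVal a = diag(z(r), 1, z(r)⁻¹)` then `diagUnit a = (z(r), 1, z(r⁻¹))`. [cite: Rogawski1990, §2.2 (p. 13)] -/
theorem coe_diagUnit_of_adelicVal_eq_ray {r : ℝ≥0ˣ} {a : (quasiSplit F E c 3).Adelic} (ha : a ∈ borelAdelic F E c 3)
    (hval : adelicVal F E c 3 ((StdForm.antidiagonal 3).over E) a =
      glDiagonal 3 (AdeleRing (𝓞 E) E) ![posRealIdele E r, 1, posRealIdele E r⁻¹]) (i : Fin 3) :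
    (diagUnit ha i : AdeleRing (𝓞 E) E) = ((![posRealIdele E r, 1, posRealIdele E r⁻¹] i : (AdeleRing (𝓞 E) E)ˣ) : AdeleRing (𝓞 E) E) := by
  rw [coe_diagUnit, hval, coe_glDiagonal, Matrix.diagonal_apply_eq]

/-- The root values of a cone element, as adeles: `d₀⁻¹ d₁ = realAdele(r⁻¹)`, `d₀⁻¹ d₂ = realAdele(r⁻¹)²` (`z(r)⁻¹ = z(r⁻¹)`, ★ `coe_posRealIdele`). [cite: Rogawski1990, §2.2 (p. 13)] -/
theorem rootValues_of_adelicVal_eq_ray {r : ℝ≥0ˣ} {a : (quasiSplit F E c 3).Adelic} (ha : a ∈ borelAdelic F E c 3)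
    (hval : adelicVal F E c 3 ((StdForm.antidiagonal 3).over E) a =
      glDiagonal 3 (AdeleRing (𝓞 E) E) ![posRealIdele E r, 1, posRealIdele E r⁻¹]) :
    (((diagUnit ha 0)⁻¹ * diagUnit ha 1 : (AdeleRing (𝓞 E) E)ˣ) : AdeleRing (𝓞 E) E) = realAdele E (((r⁻¹ : ℝ≥0ˣ) : ℝ≥0) : ℝ) ∧
      (((diagUnit ha 0)⁻¹ * diagUnit ha 2 : (AdeleRing (𝓞 E) E)ˣ) : AdeleRing (𝓞 E) E) =
        realAdele E (((r⁻¹ : ℝ≥0ˣ) : ℝ≥0) : ℝ) * realAdele E (((r⁻¹ : ℝ≥0ˣ) : ℝ≥0) : ℝ) := by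
  have h0 : diagUnit ha 0 = posRealIdele E r := Units.ext (coe_diagUnit_of_adelicVal_eq_ray ha hval 0)
  have h1 : diagUnit ha 1 = 1 := Units.ext (coe_diagUnit_of_adelicVal_eq_ray ha hval 1)
  have h2 : diagUnit ha 2 = posRealIdele E r⁻¹ := Units.ext (coe_diagUnit_of_adelicVal_eq_ray ha hval 2)
  rw [h0, h1, h2, mul_one, ← map_inv, Units.val_mul, coe_posRealIdele]
  exact ⟨rfl, rfl⟩

/-- **THE SIEGEL DISCHARGE.**  Let `Ω ⊆ G(𝔸_F)` be compact with `Ω ⊆ B(𝔸_F)` and `t > 0`.  There are compact `Ω' ⊆ G(𝔸_F)` and `R₁, R₂ ⊆ 𝔸_E` such that for every `ω ∈ Ω` and every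
cone element `a` (`adelicVal a ∈ siegelCone 3 E t`, i.e. `a = diag(z(r), 1, z(r)⁻¹)` with `r ≥ t`, ★ `exists_ray_of_adelicVal_mem_siegelCone`) the Borel element `b = ω·a` has
unipotent part `(torusPart b)⁻¹ b = a⁻¹·n_ω·a ∈ Ω'` (`n_ω = (torusPart ω)⁻¹ ω` ranges in a compact of `N(𝔸_F)`, and `Ad(a⁻¹)` CONTRACTS it: ★ `exists_isCompact_torusConj_mem` with the
root values `z(r⁻¹) ∈ realAdele '' [0, t⁻¹]`, `z(r⁻¹)²` of `a`, compact AS ADELES) and root values `ρᵢ(b) = ρᵢ(torusPart ω) · ρᵢ(a) ∈ Rᵢ` (★ `rootValue₁_mul`, ★ `rootValue₂_mul`;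
`ρᵢ(torusPart ω)` ranges over a continuous image of the compact `Ω`, ★ `continuous_rootValueᵢ`) — the three membership hypotheses of §2 ∕ ★ H4-d.  This is the structure clause
«on `𝔖 = ω A_t K` the set `a⁻¹ ω a` stays in a fixed compact» of reduction theory. [cite: Borel1963, §5] [cite: Rogawski1990, §2.2 (p. 13)] [cite: Arthur1978TraceFormulaI, §5] -/
theorem exists_isCompact_structure_of_mem_mul_cone (hc : c * c = 1)
    {Ω : Set (quasiSplit F E c 3).Adelic} (hΩc : IsCompact Ω) (hΩB : Ω ⊆ (borelAdelic F E c 3 : Set (quasiSplit F E c 3).Adelic))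
    {t : ℝ} (ht : 0 < t) :
    ∃ Ω' : Set (quasiSplit F E c 3).Adelic, IsCompact Ω' ∧ ∃ R₁ R₂ : Set (AdeleRing (𝓞 E) E), IsCompact R₁ ∧ IsCompact R₂ ∧
      ∀ ω ∈ Ω, ∀ a : (quasiSplit F E c 3).Adelic, adelicVal F E c 3 ((StdForm.antidiagonal 3).over E) a ∈ siegelCone 3 E t →
        ∃ hb : ω * a ∈ borelAdelic F E c 3,
          (((torusPart ⟨ω * a, hb⟩)⁻¹ * ⟨ω * a, hb⟩ : borelAdelic F E c 3) : (quasiSplit F E c 3).Adelic) ∈ Ω' ∧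
          (((diagUnit hb 0)⁻¹ * diagUnit hb 1 : (AdeleRing (𝓞 E) E)ˣ) : AdeleRing (𝓞 E) E) ∈ R₁ ∧
          (((diagUnit hb 0)⁻¹ * diagUnit hb 2 : (AdeleRing (𝓞 E) E)ˣ) : AdeleRing (𝓞 E) E) ∈ R₂ := by
  -- `Ω` as a compact subset `ΩB` of `B(𝔸_F)`; its torus parts; their root values `U₁, U₂`
  set ΩB : Set (borelAdelic F E c 3) := (Subtype.val : borelAdelic F E c 3 → (quasiSplit F E c 3).Adelic) ⁻¹' Ω with hΩB'
  have hΩBc : IsCompact ΩB := isClosed_borelAdelic.isClosedEmbedding_subtypeVal.isCompact_preimage hΩc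
  have hTc : IsCompact (torusPart '' ΩB) := hΩBc.image continuous_torusPart
  set U₁ : Set (AdeleRing (𝓞 E) E) := (fun s : borelAdelic F E c 3 =>
    (((diagUnit s.2 0)⁻¹ * diagUnit s.2 1 : (AdeleRing (𝓞 E) E)ˣ) : AdeleRing (𝓞 E) E)) '' (torusPart '' ΩB) with hU₁
  set U₂ : Set (AdeleRing (𝓞 E) E) := (fun s : borelAdelic F E c 3 =>
    (((diagUnit s.2 0)⁻¹ * diagUnit s.2 2 : (AdeleRing (𝓞 E) E)ˣ) : AdeleRing (𝓞 E) E)) '' (torusPart '' ΩB) with hU₂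
  have hU₁c : IsCompact U₁ := hTc.image continuous_rootValue₁
  have hU₂c : IsCompact U₂ := hTc.image continuous_rootValue₂
  -- the ray window `z([0, t⁻¹])`, compact in `𝔸_E`, and its square
  set Ray : Set (AdeleRing (𝓞 E) E) := realAdele E '' Icc 0 t⁻¹ with hRay
  have hRayc : IsCompact Ray := isCompact_Icc.image (continuous_realAdele E)
  set Ray₂ : Set (AdeleRing (𝓞 E) E) := (fun p : AdeleRing (𝓞 E) E => p * p) '' Ray with hRay₂
  have hRay₂c : IsCompact Ray₂ := hRayc.image (continuous_id.mul continuous_id)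
  -- the windows `R₁ = U₁ · Ray`, `R₂ = U₂ · Ray₂`
  set R₁ : Set (AdeleRing (𝓞 E) E) := (fun p : AdeleRing (𝓞 E) E × AdeleRing (𝓞 E) E => p.1 * p.2) '' (U₁ ×ˢ Ray) with hR₁
  set R₂ : Set (AdeleRing (𝓞 E) E) := (fun p : AdeleRing (𝓞 E) E × AdeleRing (𝓞 E) E => p.1 * p.2) '' (U₂ ×ˢ Ray₂) with hR₂
  have hR₁c : IsCompact R₁ := (hU₁c.prod hRayc).image (continuous_fst.mul continuous_snd)
  have hR₂c : IsCompact R₂ := (hU₂c.prod hRay₂c).image (continuous_fst.mul continuous_snd)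
  -- the unipotent parts `n_ω = (torusPart ω)⁻¹ ω`, `ω ∈ Ω`, as a compact subset `W` of `N(𝔸_F)`, and the contraction window `W'`
  set nmap : borelAdelic F E c 3 → adelicUnipotent F E c 3 := fun s =>
    ⟨(((torusPart s)⁻¹ * s : borelAdelic F E c 3) : (quasiSplit F E c 3).Adelic), torusPart_inv_mul_mem_adelicUnipotent s⟩ with hnmap
  have hncont : Continuous nmap := ((continuous_torusPart.inv.mul continuous_id).subtype_val).subtype_mk _
  set W : Set (adelicUnipotent F E c 3) := nmap '' ΩB with hW
  have hWc : IsCompact W := hΩBc.image hncont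
  obtain ⟨W', hW'c, hW'⟩ := exists_isCompact_torusConj_mem hc hWc hRayc hRay₂c
  refine ⟨(fun m : adelicUnipotent F E c 3 => (m : (quasiSplit F E c 3).Adelic)) '' W', hW'c.image continuous_subtype_val,
    R₁, R₂, hR₁c, hR₂c, fun ω hω a ha => ?_⟩
  -- the cone element `a = diag(z(r), 1, z(r)⁻¹)`, `r ≥ t`, a torus element
  obtain ⟨r, htr, -, hval⟩ := exists_ray_of_adelicVal_mem_siegelCone ha
  have haT : a ∈ torusAdelic F E c 3 := ⟨_, hval.symm⟩
  have haB : a ∈ borelAdelic F E c 3 := torusAdelic_le_borelAdelic haT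
  have hωB : ω ∈ borelAdelic F E c 3 := hΩB hω
  set ωb : borelAdelic F E c 3 := ⟨ω, hωB⟩ with hωb
  set ab : borelAdelic F E c 3 := ⟨a, haB⟩ with hab
  have hωΩB : ωb ∈ ΩB := hω
  have htab : torusPart ab = ab := torusPart_eq_self_of_mem haT
  have htω : torusPart (torusPart ωb) = torusPart ωb := torusPart_eq_self_of_mem (torusPart_mem_torusAdelic ωb)
  refine ⟨(ωb * ab).2, ?_⟩
  have hbeq : (⟨ω * a, (ωb * ab).2⟩ : borelAdelic F E c 3) = ωb * ab := rfl
  rw [hbeq]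
  -- the root values of `a`: `z(r⁻¹) ∈ Ray`, `z(r⁻¹)² ∈ Ray₂`
  obtain ⟨hρ₁a, hρ₂a⟩ := rootValues_of_adelicVal_eq_ray haB hval
  have hrinv : (((r⁻¹ : ℝ≥0ˣ) : ℝ≥0) : ℝ) ∈ Icc 0 t⁻¹ := by
    refine ⟨NNReal.coe_nonneg _, ?_⟩
    have hr0 : 0 < ((r : ℝ≥0) : ℝ) := ht.trans_le htr
    rw [Units.val_inv_eq_inv_val, NNReal.coe_inv]
    exact (inv_le_inv₀ hr0 ht).2 htr
  have hray₁ : (((diagUnit haB 0)⁻¹ * diagUnit haB 1 : (AdeleRing (𝓞 E) E)ˣ) : AdeleRing (𝓞 E) E) ∈ Ray := by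
    rw [hρ₁a]
    exact Set.mem_image_of_mem _ hrinv
  have hray₂ : (((diagUnit haB 0)⁻¹ * diagUnit haB 2 : (AdeleRing (𝓞 E) E)ˣ) : AdeleRing (𝓞 E) E) ∈ Ray₂ := by
    rw [hρ₂a]
    exact ⟨_, Set.mem_image_of_mem _ hrinv, rfl⟩
  -- torus part and unipotent part of `b = ω a`
  have hTP : torusPart (ωb * ab) = torusPart ωb * ab := by rw [torusPart_mul, htab]
  refine ⟨?_, ?_, ?_⟩
  · -- `(torusPart b)⁻¹ b = a⁻¹ · n_ω · a ∈ W'`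
    have hmem := hW' a haT (diagUnit haB) (adelicVal_eq_glDiagonal_of_torusPart_eq htab).symm hray₁ hray₂ (nmap ωb)
      (Set.mem_image_of_mem _ hωΩB)
    refine ⟨_, hmem, ?_⟩
    change a⁻¹ * ((((torusPart ωb)⁻¹ * ωb : borelAdelic F E c 3)) : (quasiSplit F E c 3).Adelic) * a =
      ((((torusPart (ωb * ab))⁻¹ * (ωb * ab) : borelAdelic F E c 3)) : (quasiSplit F E c 3).Adelic)
    rw [hTP]
    simp only [Subgroup.coe_mul, InvMemClass.coe_inv, mul_inv_rev]
    change a⁻¹ * ((((torusPart ωb : borelAdelic F E c 3)) : (quasiSplit F E c 3).Adelic)⁻¹ * ω) * a =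
      a⁻¹ * (((torusPart ωb : borelAdelic F E c 3)) : (quasiSplit F E c 3).Adelic)⁻¹ * (ω * a)
    group
  · -- `ρ₁(b) = ρ₁(torusPart ω) · ρ₁(a) ∈ U₁ · Ray`
    rw [← diagUnit_torusPart (ωb * ab) 0, ← diagUnit_torusPart (ωb * ab) 1]
    simp only [hTP]
    rw [rootValue₁_mul htω htab]
    exact ⟨(_, _), Set.mk_mem_prod ⟨torusPart ωb, Set.mem_image_of_mem _ hωΩB, rfl⟩ hray₁, rfl⟩
  · -- `ρ₂(b) = ρ₂(torusPart ω) · ρ₂(a) ∈ U₂ · Ray₂`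
    rw [← diagUnit_torusPart (ωb * ab) 0, ← diagUnit_torusPart (ωb * ab) 2]
    simp only [hTP]
    rw [rootValue₂_mul htω htab]
    exact ⟨(_, _), Set.mk_mem_prod ⟨torusPart ωb, Set.mem_image_of_mem _ hωΩB, rfl⟩ hray₂, rfl⟩

/-! ## §4 The head in the currency of (A3): `#(B(F)♯ ∩ {x | x(ωa) = (ωa)d, d ∈ D}) ≤ M · H(ωa)²` on the Borel part of the Siegel set -/

/-- **ON A SIEGEL SET THE RATIONAL BOREL ELEMENTS CONJUGATE TO A COMPACT SET NUMBER `O(H²)`.**  For `c² = 1 ≠ c`, compact `Ω ⊆ B(𝔸_F)`, `t > 0` and compact `D ⊆ G(𝔸_F)` there is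
`M : ℝ≥0` with
  `#(B(F)♯ ∩ {x | ∃ d ∈ D, x·(ωa) = (ωa)·d}) ≤ M · H(ωa)²`
for every `ω ∈ Ω` and every cone element `a` (`adelicVal a ∈ siegelCone 3 E t`) — §2 on the structure clause §3, and `δ_B(b) = H(b)²` at `N = 3` (★
`torusRootModulus_diagUnit_eq_borelHeight_mul_self`).  With ★ (A1) `K2E1RationalPointsNearBorel.exists_smear_inter_smul_mul_inv_subset_three` (`G(F) ∩ (g•C)(g•C)⁻¹ ⊆ B(F)♯ ∩
{x | ∃ d ∈ K(CC⁻¹)K⁻¹, x b = b d}` for `g = b k` of height `H(g)² > A`) this is the multiplicity growth `m_g ≤ M·H(b)²` of Godement's count on the Siegel set `𝔖 = Ω·A(t)·K` of ★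
`K2E1ReductionTheoryU3.exists_siegel_cover_three` — the input of (A3) `K2E1BorelEisensteinModerateGrowth`. [cite: Rogawski1990, §2.2 (p. 13)] [cite: Arthur1978TraceFormulaI, §5]
[cite: MoeglinWaldspurger1995, II.1.5] [cite: Godement1964, §8] -/
theorem exists_forall_ncard_le_mul_borelHeight_sq (hc : c * c = 1) (hc1 : c ≠ 1)
    {Ω : Set (quasiSplit F E c 3).Adelic} (hΩc : IsCompact Ω) (hΩB : Ω ⊆ (borelAdelic F E c 3 : Set (quasiSplit F E c 3).Adelic))
    {t : ℝ} (ht : 0 < t) {D : Set (quasiSplit F E c 3).Adelic} (hD : IsCompact D) :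
    ∃ M : ℝ≥0, ∀ ω ∈ Ω, ∀ a : (quasiSplit F E c 3).Adelic, adelicVal F E c 3 ((StdForm.antidiagonal 3).over E) a ∈ siegelCone 3 E t →
      (((((arithmeticBorel F E c 3).map (quasiSplit F E c 3).arithmeticSubgroup.subtype : Set (quasiSplit F E c 3).Adelic) ∩
          {x | ∃ d ∈ D, x * (ω * a) = (ω * a) * d}).ncard : ℕ) : ℝ≥0) ≤ M * (borelHeight (ω * a) * borelHeight (ω * a)) := by
  obtain ⟨Ω', hΩ', R₁, R₂, hR₁, hR₂, hstr⟩ := exists_isCompact_structure_of_mem_mul_cone hc hΩc hΩB ht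
  obtain ⟨M, hM⟩ := exists_forall_ncard_le_mul_torusRootModulus hc hc1 hD hΩ' hR₁ hR₂
  refine ⟨M, fun ω hω a ha => ?_⟩
  obtain ⟨hb, h0, h1, h2⟩ := hstr ω hω a ha
  have h := hM ⟨ω * a, hb⟩ h0 h1 h2
  rwa [torusRootModulus_diagUnit_eq_borelHeight_mul_self] at h

/-- **The same in the letters of ★ `K2E1ReductionTheoryU3.exists_siegel_cover_three`** (`adelicVal '' Ω ⊆ N(𝔸_E)·T(𝔸_E)¹` instead of `Ω ⊆ B(𝔸_F)`; §1
`subset_borelAdelic_of_image_subset`). [cite: Rogawski1990, §2.2 (p. 13)] [cite: Arthur1978TraceFormulaI, §5] [cite: Borel1963, §5] -/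
theorem exists_forall_ncard_le_mul_borelHeight_sq_of_image_subset (hc : c * c = 1) (hc1 : c ≠ 1)
    {Ω : Set (quasiSplit F E c 3).Adelic} (hΩc : IsCompact Ω)
    (hΩN : adelicVal F E c 3 ((StdForm.antidiagonal 3).over E) '' Ω ⊆
      (upperUnitriangular (Fin 3) (AdeleRing (𝓞 E) E) : Set (GL (Fin 3) (AdeleRing (𝓞 E) E))) *
        (normOneDiagonal 3 E : Set (GL (Fin 3) (AdeleRing (𝓞 E) E))))
    {t : ℝ} (ht : 0 < t) {D : Set (quasiSplit F E c 3).Adelic} (hD : IsCompact D) :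
    ∃ M : ℝ≥0, ∀ ω ∈ Ω, ∀ a : (quasiSplit F E c 3).Adelic, adelicVal F E c 3 ((StdForm.antidiagonal 3).over E) a ∈ siegelCone 3 E t →
      (((((arithmeticBorel F E c 3).map (quasiSplit F E c 3).arithmeticSubgroup.subtype : Set (quasiSplit F E c 3).Adelic) ∩
          {x | ∃ d ∈ D, x * (ω * a) = (ω * a) * d}).ncard : ℕ) : ℝ≥0) ≤ M * (borelHeight (ω * a) * borelHeight (ω * a)) :=
  exists_forall_ncard_le_mul_borelHeight_sq hc hc1 hΩc (subset_borelAdelic_of_image_subset hΩN) ht hD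

end Summit.HodgeConjecture.HodgeConjecture.Cruxes.H413.K2E1BorelLatticeCount

end
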